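import Summits.CriticalPhenomena.PercolationContinuityZ3.Theorems.PercNearOneGluingNoHeavyLowerTailSunflowerBoxFibresA
import Summits.CriticalPhenomena.PercolationContinuityZ3.Theorems.PercNearOneGluingNoHeavyLowerTailSunflowerBoxFibresB

/-!
# Exact vertex reduction on a BOX of the petal polytope (boxed-exemption criterion for (RES0′), step 1)

(prove-1 gen 58, memo run/shared/lean/prim/prim-ineq-prove-1/FINDING-BOXED-prove1-g58.md §2.)  Model of g52 §0 (see
`…SunflowerBoxFibresA`).  A BOX is the part of the petal polytope `{α₀₀ ≤ y ≤ k ≤ 1, α₀₁ ≤ g ≤ min(k,h), α₁₁ ≤ h ≤ 1}` with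
`k ∈ [k₁,k₂]`, `g ∈ [g₁,g₂]`, `h ∈ [h₁,h₂]` (`y` is never boxed).  **`box_one_petal`**: if the six-budget power inequality
`G(v) ≤ C·(y/α₀₀)^λ_y (k/α₀₁)^λ_k (g/α₀₁)^λ_g (h/α₁₁)^λ_h (Ȳ/b_Ȳ)^λ_Ȳ (H/b_H)^λ_H` (`C > 0`, `λ ≥ 0`, leaf-leaf constant
`c₀ ≥ τσ + (1−τ)(1−s)α₀₀`) holds at every GRID POINT of the box — the points of the box with `y ∈ {α₀₀, k}` and
`k, g, h ∈ {k₁,k₂,g₁,g₂,h₁,h₂}` (a superset of its vertices) — then it holds at EVERY petal of the box.  Proof: elimination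
`g → {g₁, g₂, k, h}`, then the facets, along the root-ordered fibres of `…SunflowerBoxFibresA/B` (every step is an exact endpoint
interpolation in the variable `log G`).  With `k₁ = g₁ = α₀₁`, `k₂ = g₂ = h₂ = 1`, `h₁ = α₁₁`, `C = g` this is g57's `vertex_one_petal`;
the boxed-exemption criterion applies it to the SMALL region (capped box) with `C = g` and to each exempt petal's box with `C = g·e^z`. [this work]
-/

namespace Summit.CriticalPhenomena.PercolationContinuityZ3.Theorems.SunflowerPartition.SafeCalc.LinkedCurrency

section BoxReduction
variable {τ σ s α00 α01 α11 c0 C ly lk lg lh lX lH k1 k2 g1 g2 h1 h2 : ℝ}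
/- Parameters / exponents / constant (as in the fibre files). -/
variable (hP : 0 < τ ∧ τ < 1 ∧ 0 < σ ∧ σ < 1 ∧ 0 < s ∧ s < 1 ∧ 0 < α00 ∧ α00 ≤ α01 ∧ α01 ≤ α11 ∧ α11 ≤ 1 ∧
      τ * σ + (1 - τ) * (1 - s) * α00 ≤ c0 ∧ 0 ≤ ly ∧ 0 ≤ lk ∧ 0 ≤ lg ∧ 0 ≤ lh ∧ 0 ≤ lX ∧ 0 ≤ lH ∧ 0 < C)
/- The box: `k ∈ [k₁,k₂] ⊆ [α₀₁,1]`, `g ∈ [g₁,g₂]`, `g₁ ≥ α₀₁`, `h ∈ [h₁,h₂] ⊆ [α₁₁,1]`. -/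
variable (hB : α01 ≤ k1 ∧ k1 ≤ k2 ∧ k2 ≤ 1 ∧ α01 ≤ g1 ∧ g1 ≤ g2 ∧ α11 ≤ h1 ∧ h1 ≤ h2 ∧ h2 ≤ 1)
/- GRID HYPOTHESIS: the inequality at every point of the box with `y ∈ {α₀₀,k}` and `k,g,h` among the six box values. -/
variable (hV : ∀ y k gc h : ℝ, α00 ≤ y → y ≤ k → k1 ≤ k → k ≤ k2 → g1 ≤ gc → gc ≤ g2 → gc ≤ k → gc ≤ h → h1 ≤ h → h ≤ h2 →
      (y = α00 ∨ y = k) → (k = k1 ∨ k = k2 ∨ k = g1 ∨ k = g2 ∨ k = h1 ∨ k = h2) → (gc = k1 ∨ gc = k2 ∨ gc = g1 ∨ gc = g2 ∨ gc = h1 ∨ gc = h2) → (h = k1 ∨ h = k2 ∨ h = g1 ∨ h = g2 ∨ h = h1 ∨ h = h2) →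
      (c0 + τ * (1 - σ) * ((1 - s) * y + s * k) + s * (1 - τ) * ((1 - σ) * gc + σ * h)) ≤ C * (y / α00) ^ ly * (k / α01) ^ lk * (gc / α01) ^ lg * (h / α11) ^ lh * (((1 - s) * y + s * k) / ((1 - s) * α00 + s * α01)) ^ lX * (((1 - σ) * gc + σ * h) / ((1 - σ) * α01 + σ * α11)) ^ lH)
include hP hB hV

/-- Slice `g = c`, `h = η` of the box (`c, η` grid values, `m = max(k₁,c)` a grid value): the inequality at every `(y,k,c,η)` with
`α₀₀ ≤ y ≤ k`, `m ≤ k ≤ k₂`, from the grid points `(α₀₀,m,c,η)`, `(m,m,c,η)`, `(α₀₀,k₂,c,η)`, `(k₂,k₂,c,η)` (fibres `y`, `y = k`, `k`). [this work] -/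
theorem box_yk : ∀ c η m : ℝ, g1 ≤ c → c ≤ g2 → (c = k1 ∨ c = k2 ∨ c = g1 ∨ c = g2 ∨ c = h1 ∨ c = h2) → h1 ≤ η → η ≤ h2 → c ≤ η → (η = k1 ∨ η = k2 ∨ η = g1 ∨ η = g2 ∨ η = h1 ∨ η = h2) →
    (m = k1 ∨ m = k2 ∨ m = g1 ∨ m = g2 ∨ m = h1 ∨ m = h2) → k1 ≤ m → c ≤ m → m ≤ k2 →
    ∀ y k : ℝ, α00 ≤ y → y ≤ k → m ≤ k → k ≤ k2 → (c0 + τ * (1 - σ) * ((1 - s) * y + s * k) + s * (1 - τ) * ((1 - σ) * c + σ * η)) ≤ C * (y / α00) ^ ly * (k / α01) ^ lk * (c / α01) ^ lg * (η / α11) ^ lh * (((1 - s) * y + s * k) / ((1 - s) * α00 + s * α01)) ^ lX * (((1 - σ) * c + σ * η) / ((1 - σ) * α01 + σ * α11)) ^ lH := by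
  obtain ⟨hτ0, hτ1, hσ0, hσ1, hs0, hs1, hα00, h01, h11, hα1, hc0, hly, hlk, hlg, hlh, hlX, hlH, hC0⟩ := id hP
  obtain ⟨hk1, hk12, hk21, hg1, hg12, hh1, hh12, hh21⟩ := id hB
  have hα01 : 0 < α01 := lt_of_lt_of_le hα00 h01
  have hα11 : 0 < α11 := lt_of_lt_of_le hα01 h11
  have hk1p : 0 < k1 := lt_of_lt_of_le hα01 hk1
  have hg1p : 0 < g1 := lt_of_lt_of_le hα01 hg1
  have hh1p : 0 < h1 := lt_of_lt_of_le hα11 hh1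
  intro c η m hgc hcg hcS hη1 hη2 hcη hηS hmS hkm hcm hmk y k hy hyk hmk' hkk2
  have hcα : α01 ≤ c := hg1.trans hgc
  have hηα : α11 ≤ η := hh1.trans hη1
  have hmα : α01 ≤ m := hk1.trans hkm
  have hmp : 0 < m := lt_of_lt_of_le hα01 hmα
  have hk2α : α01 ≤ k2 := hk1.trans hk12
  have hαm : α00 ≤ m := h01.trans hmα
  have hαk2 : α00 ≤ k2 := h01.trans hk2α
  -- the four grid points
  have e_am : (c0 + τ * (1 - σ) * ((1 - s) * α00 + s * m) + s * (1 - τ) * ((1 - σ) * c + σ * η)) ≤ C * (α00 / α00) ^ ly * (m / α01) ^ lk * (c / α01) ^ lg * (η / α11) ^ lh * (((1 - s) * α00 + s * m) / ((1 - s) * α00 + s * α01)) ^ lX * (((1 - σ) * c + σ * η) / ((1 - σ) * α01 + σ * α11)) ^ lH :=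
    hV α00 m c η (le_refl α00) hαm hkm hmk hgc hcg hcm hcη hη1 hη2 (Or.inl rfl) hmS hcS hηS
  have e_mm : (c0 + τ * (1 - σ) * ((1 - s) * m + s * m) + s * (1 - τ) * ((1 - σ) * c + σ * η)) ≤ C * (m / α00) ^ ly * (m / α01) ^ lk * (c / α01) ^ lg * (η / α11) ^ lh * (((1 - s) * m + s * m) / ((1 - s) * α00 + s * α01)) ^ lX * (((1 - σ) * c + σ * η) / ((1 - σ) * α01 + σ * α11)) ^ lH :=
    hV m m c η hαm (le_refl m) hkm hmk hgc hcg hcm hcη hη1 hη2 (Or.inr rfl) hmS hcS hηS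
  have e_ak : (c0 + τ * (1 - σ) * ((1 - s) * α00 + s * k2) + s * (1 - τ) * ((1 - σ) * c + σ * η)) ≤ C * (α00 / α00) ^ ly * (k2 / α01) ^ lk * (c / α01) ^ lg * (η / α11) ^ lh * (((1 - s) * α00 + s * k2) / ((1 - s) * α00 + s * α01)) ^ lX * (((1 - σ) * c + σ * η) / ((1 - σ) * α01 + σ * α11)) ^ lH :=
    hV α00 k2 c η (le_refl α00) hαk2 hk12 (le_refl k2) hgc hcg (hcm.trans hmk) hcη hη1 hη2 (Or.inl rfl) (Or.inr (Or.inl rfl)) hcS hηS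
  have e_kk : (c0 + τ * (1 - σ) * ((1 - s) * k2 + s * k2) + s * (1 - τ) * ((1 - σ) * c + σ * η)) ≤ C * (k2 / α00) ^ ly * (k2 / α01) ^ lk * (c / α01) ^ lg * (η / α11) ^ lh * (((1 - s) * k2 + s * k2) / ((1 - s) * α00 + s * α01)) ^ lX * (((1 - σ) * c + σ * η) / ((1 - σ) * α01 + σ * α11)) ^ lH :=
    hV k2 k2 c η hαk2 (le_refl k2) hk12 (le_refl k2) hgc hcg (hcm.trans hmk) hcη hη1 hη2 (Or.inr rfl) (Or.inr (Or.inl rfl)) hcS hηS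
  have ehi : (c0 + τ * (1 - σ) * ((1 - s) * y + s * k2) + s * (1 - τ) * ((1 - σ) * c + σ * η)) ≤ C * (y / α00) ^ ly * (k2 / α01) ^ lk * (c / α01) ^ lg * (η / α11) ^ lh * (((1 - s) * y + s * k2) / ((1 - s) * α00 + s * α01)) ^ lX * (((1 - σ) * c + σ * η) / ((1 - σ) * α01 + σ * α11)) ^ lH :=
    bfib_y hP k2 c η α00 k2 hk2α hcα hηα hα00 e_ak e_kk y hy (hyk.trans hkk2)
  rcases le_total y m with hym | hmy
  · have elo : (c0 + τ * (1 - σ) * ((1 - s) * y + s * m) + s * (1 - τ) * ((1 - σ) * c + σ * η)) ≤ C * (y / α00) ^ ly * (m / α01) ^ lk * (c / α01) ^ lg * (η / α11) ^ lh * (((1 - s) * y + s * m) / ((1 - s) * α00 + s * α01)) ^ lX * (((1 - σ) * c + σ * η) / ((1 - σ) * α01 + σ * α11)) ^ lH :=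
      bfib_y hP m c η α00 m hmα hcα hηα hα00 e_am e_mm y hy hym
    exact bfib_k hP y c η m k2 hy hcα hηα hmp elo ehi k hmk' hkk2
  · have elo : (c0 + τ * (1 - σ) * ((1 - s) * y + s * y) + s * (1 - τ) * ((1 - σ) * c + σ * η)) ≤ C * (y / α00) ^ ly * (y / α01) ^ lk * (c / α01) ^ lg * (η / α11) ^ lh * (((1 - s) * y + s * y) / ((1 - s) * α00 + s * α01)) ^ lX * (((1 - σ) * c + σ * η) / ((1 - σ) * α01 + σ * α11)) ^ lH :=
      bfib_yk hP c η m k2 hcα hηα hmp e_mm e_kk y hmy (hyk.trans hkk2)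
    exact bfib_k hP y c η y k2 hy hcα hηα (lt_of_lt_of_le hmp hmy) elo ehi k hyk hkk2

/-- Facet `g = c` of the box (`c` a grid value in `[g₁,g₂]`): every petal `(y,k,c,h)` of the box (fibre `h` between the slices
`h = max(h₁,c)` and `h = h₂` of `box_yk`). [this work] -/
theorem box_faceC : ∀ c : ℝ, g1 ≤ c → c ≤ g2 → (c = k1 ∨ c = k2 ∨ c = g1 ∨ c = g2 ∨ c = h1 ∨ c = h2) →
    ∀ y k h : ℝ, α00 ≤ y → y ≤ k → k1 ≤ k → k ≤ k2 → c ≤ k → c ≤ h → h1 ≤ h → h ≤ h2 → (c0 + τ * (1 - σ) * ((1 - s) * y + s * k) + s * (1 - τ) * ((1 - σ) * c + σ * h)) ≤ C * (y / α00) ^ ly * (k / α01) ^ lk * (c / α01) ^ lg * (h / α11) ^ lh * (((1 - s) * y + s * k) / ((1 - s) * α00 + s * α01)) ^ lX * (((1 - σ) * c + σ * h) / ((1 - σ) * α01 + σ * α11)) ^ lH := by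
  have L1 := box_yk hP hB hV
  obtain ⟨hτ0, hτ1, hσ0, hσ1, hs0, hs1, hα00, h01, h11, hα1, hc0, hly, hlk, hlg, hlh, hlX, hlH, hC0⟩ := id hP
  obtain ⟨hk1, hk12, hk21, hg1, hg12, hh1, hh12, hh21⟩ := id hB
  have hα01 : 0 < α01 := lt_of_lt_of_le hα00 h01
  have hα11 : 0 < α11 := lt_of_lt_of_le hα01 h11
  have hk1p : 0 < k1 := lt_of_lt_of_le hα01 hk1
  have hg1p : 0 < g1 := lt_of_lt_of_le hα01 hg1
  have hh1p : 0 < h1 := lt_of_lt_of_le hα11 hh1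
  intro c hgc hcg hcS y k h hy hyk hk1k hkk2 hck hch hh1h hhh2
  have hcα : α01 ≤ c := hg1.trans hgc
  have hch2 : c ≤ h2 := hch.trans hhh2
  -- m = max(k1, c) as a grid value
  obtain ⟨m, hmS, hkm, hcm, hmk, hmle⟩ : ∃ m : ℝ, (m = k1 ∨ m = k2 ∨ m = g1 ∨ m = g2 ∨ m = h1 ∨ m = h2) ∧ k1 ≤ m ∧ c ≤ m ∧ m ≤ k2 ∧ m ≤ k := by
    rcases le_total c k1 with hc1 | h1c
    · exact ⟨k1, (Or.inl rfl), le_refl k1, hc1, hk12, hk1k⟩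
    · exact ⟨c, hcS, h1c, le_refl c, hck.trans hkk2, hck⟩
  -- η₀ = max(h1, c) as a grid value
  obtain ⟨η0, hη0S, hη01, hcη0, hη0h, hη02⟩ : ∃ η0 : ℝ, (η0 = k1 ∨ η0 = k2 ∨ η0 = g1 ∨ η0 = g2 ∨ η0 = h1 ∨ η0 = h2) ∧ h1 ≤ η0 ∧ c ≤ η0 ∧ η0 ≤ h ∧ η0 ≤ h2 := by
    rcases le_total c h1 with hc1 | h1c
    · exact ⟨h1, (Or.inr (Or.inr (Or.inr (Or.inr (Or.inl rfl))))), le_refl h1, hc1, hh1h, hh12⟩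
    · exact ⟨c, hcS, h1c, le_refl c, hch, hch2⟩
  have hη0p : 0 < η0 := lt_of_lt_of_le hh1p hη01
  have e_lo : (c0 + τ * (1 - σ) * ((1 - s) * y + s * k) + s * (1 - τ) * ((1 - σ) * c + σ * η0)) ≤ C * (y / α00) ^ ly * (k / α01) ^ lk * (c / α01) ^ lg * (η0 / α11) ^ lh * (((1 - s) * y + s * k) / ((1 - s) * α00 + s * α01)) ^ lX * (((1 - σ) * c + σ * η0) / ((1 - σ) * α01 + σ * α11)) ^ lH :=
    L1 c η0 m hgc hcg hcS hη01 hη02 hcη0 hη0S hmS hkm hcm hmk y k hy hyk hmle hkk2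
  have e_hi : (c0 + τ * (1 - σ) * ((1 - s) * y + s * k) + s * (1 - τ) * ((1 - σ) * c + σ * h2)) ≤ C * (y / α00) ^ ly * (k / α01) ^ lk * (c / α01) ^ lg * (h2 / α11) ^ lh * (((1 - s) * y + s * k) / ((1 - s) * α00 + s * α01)) ^ lX * (((1 - σ) * c + σ * h2) / ((1 - σ) * α01 + σ * α11)) ^ lH :=
    L1 c h2 m hgc hcg hcS hh12 (le_refl h2) hch2 (Or.inr (Or.inr (Or.inr (Or.inr (Or.inr rfl))))) hmS hkm hcm hmk y k hy hyk hmle hkk2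
  exact bfib_h hP y k c η0 h2 hy (hk1.trans hk1k) hcα hη0p e_lo e_hi h hη0h hhh2

/-- Facet `g = k ≤ h` of the box: every petal `(y,t,t,h)` with `t ∈ [k₁,k₂] ∩ [g₁,g₂]`, `t ≤ h ∈ [h₁,h₂]` (fibre `y` between the
edges `(α₀₀,t,t,h)` and `(t,t,t,h)`, which come from the tied fibres `k=g`, `k=g=h`, `y=k=g`, diagonal and the fibre `h`). [this work] -/
theorem box_faceII : ∀ y t h : ℝ, α00 ≤ y → y ≤ t → k1 ≤ t → t ≤ k2 → g1 ≤ t → t ≤ g2 → t ≤ h → h1 ≤ h → h ≤ h2 →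
    (c0 + τ * (1 - σ) * ((1 - s) * y + s * t) + s * (1 - τ) * ((1 - σ) * t + σ * h)) ≤ C * (y / α00) ^ ly * (t / α01) ^ lk * (t / α01) ^ lg * (h / α11) ^ lh * (((1 - s) * y + s * t) / ((1 - s) * α00 + s * α01)) ^ lX * (((1 - σ) * t + σ * h) / ((1 - σ) * α01 + σ * α11)) ^ lH := by
  obtain ⟨hτ0, hτ1, hσ0, hσ1, hs0, hs1, hα00, h01, h11, hα1, hc0, hly, hlk, hlg, hlh, hlX, hlH, hC0⟩ := id hP
  obtain ⟨hk1, hk12, hk21, hg1, hg12, hh1, hh12, hh21⟩ := id hB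
  have hα01 : 0 < α01 := lt_of_lt_of_le hα00 h01
  have hα11 : 0 < α11 := lt_of_lt_of_le hα01 h11
  have hk1p : 0 < k1 := lt_of_lt_of_le hα01 hk1
  have hg1p : 0 < g1 := lt_of_lt_of_le hα01 hg1
  have hh1p : 0 < h1 := lt_of_lt_of_le hα11 hh1
  intro y t h hy hyt hk1t htk2 hg1t htg2 hth hh1h hhh2
  have htα : α01 ≤ t := hk1.trans hk1t
  have htp : 0 < t := lt_of_lt_of_le hα01 htα
  have hth2 : t ≤ h2 := hth.trans hhh2
  have hh1' : h ≤ 1 := hhh2.trans hh21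
  -- L = max(k1,g1), a grid value, L ≤ t
  obtain ⟨L, hLS, hk1L, hg1L, hLt⟩ : ∃ L : ℝ, (L = k1 ∨ L = k2 ∨ L = g1 ∨ L = g2 ∨ L = h1 ∨ L = h2) ∧ k1 ≤ L ∧ g1 ≤ L ∧ L ≤ t := by
    rcases le_total g1 k1 with hgk | hkg
    · exact ⟨k1, (Or.inl rfl), le_refl k1, hgk, hk1t⟩
    · exact ⟨g1, (Or.inr (Or.inr (Or.inl rfl))), hkg, le_refl g1, hg1t⟩
  have hLα : α01 ≤ L := hk1.trans hk1L
  have hLp : 0 < L := lt_of_lt_of_le hα01 hLα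
  have hαL : α00 ≤ L := h01.trans hLα
  -- U(η) = min(k2, g2, η) for η ∈ {h, h2, ...}: we need the edge (α00,·,·,η) and (·,·,·,η) on [L, U] with t ≤ U.
  -- generic edge lemmas (η a grid value with t ≤ η):
  have edgeA : ∀ η : ℝ, (η = k1 ∨ η = k2 ∨ η = g1 ∨ η = g2 ∨ η = h1 ∨ η = h2) → h1 ≤ η → η ≤ h2 → t ≤ η → (c0 + τ * (1 - σ) * ((1 - s) * α00 + s * t) + s * (1 - τ) * ((1 - σ) * t + σ * η)) ≤ C * (α00 / α00) ^ ly * (t / α01) ^ lk * (t / α01) ^ lg * (η / α11) ^ lh * (((1 - s) * α00 + s * t) / ((1 - s) * α00 + s * α01)) ^ lX * (((1 - σ) * t + σ * η) / ((1 - σ) * α01 + σ * α11)) ^ lH := by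
    intro η hηS hη1 hη2 htη
    have hηα : α11 ≤ η := hh1.trans hη1
    have hη1' : η ≤ 1 := hη2.trans hh21
    obtain ⟨U, hUS, hUk2, hUg2, hUη, htU⟩ : ∃ U : ℝ, (U = k1 ∨ U = k2 ∨ U = g1 ∨ U = g2 ∨ U = h1 ∨ U = h2) ∧ U ≤ k2 ∧ U ≤ g2 ∧ U ≤ η ∧ t ≤ U := by
      rcases le_total k2 g2 with hkg | hgk
      · rcases le_total k2 η with hke | hek
        · exact ⟨k2, (Or.inr (Or.inl rfl)), le_refl k2, hkg, hke, htk2⟩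
        · exact ⟨η, hηS, hek, hek.trans hkg, le_refl η, htη⟩
      · rcases le_total g2 η with hge | heg
        · exact ⟨g2, (Or.inr (Or.inr (Or.inr (Or.inl rfl)))), hgk, le_refl g2, hge, htg2⟩
        · exact ⟨η, hηS, heg.trans hgk, heg, le_refl η, htη⟩
    have hLU : L ≤ U := hLt.trans htU
    have e0 : (c0 + τ * (1 - σ) * ((1 - s) * α00 + s * L) + s * (1 - τ) * ((1 - σ) * L + σ * η)) ≤ C * (α00 / α00) ^ ly * (L / α01) ^ lk * (L / α01) ^ lg * (η / α11) ^ lh * (((1 - s) * α00 + s * L) / ((1 - s) * α00 + s * α01)) ^ lX * (((1 - σ) * L + σ * η) / ((1 - σ) * α01 + σ * α11)) ^ lH :=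
      hV α00 L L η (le_refl α00) hαL hk1L (hLU.trans hUk2) hg1L (hLU.trans hUg2) (le_refl L) (hLU.trans hUη) hη1 hη2 (Or.inl rfl) hLS hLS hηS
    have e1 : (c0 + τ * (1 - σ) * ((1 - s) * α00 + s * U) + s * (1 - τ) * ((1 - σ) * U + σ * η)) ≤ C * (α00 / α00) ^ ly * (U / α01) ^ lk * (U / α01) ^ lg * (η / α11) ^ lh * (((1 - s) * α00 + s * U) / ((1 - s) * α00 + s * α01)) ^ lX * (((1 - σ) * U + σ * η) / ((1 - σ) * α01 + σ * α11)) ^ lH :=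
      hV α00 U U η (le_refl α00) (hαL.trans hLU) (hk1L.trans hLU) hUk2 (hg1L.trans hLU) hUg2 (le_refl U) hUη hη1 hη2 (Or.inl rfl) hUS hUS hηS
    exact bfib_kg hP η L U hηα hη1' hLp e0 e1 t hLt htU
  have edgeB : ∀ η : ℝ, (η = k1 ∨ η = k2 ∨ η = g1 ∨ η = g2 ∨ η = h1 ∨ η = h2) → h1 ≤ η → η ≤ h2 → t ≤ η → (c0 + τ * (1 - σ) * ((1 - s) * t + s * t) + s * (1 - τ) * ((1 - σ) * t + σ * η)) ≤ C * (t / α00) ^ ly * (t / α01) ^ lk * (t / α01) ^ lg * (η / α11) ^ lh * (((1 - s) * t + s * t) / ((1 - s) * α00 + s * α01)) ^ lX * (((1 - σ) * t + σ * η) / ((1 - σ) * α01 + σ * α11)) ^ lH := by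
    intro η hηS hη1 hη2 htη
    have hηα : α11 ≤ η := hh1.trans hη1
    have hη1' : η ≤ 1 := hη2.trans hh21
    obtain ⟨U, hUS, hUk2, hUg2, hUη, htU⟩ : ∃ U : ℝ, (U = k1 ∨ U = k2 ∨ U = g1 ∨ U = g2 ∨ U = h1 ∨ U = h2) ∧ U ≤ k2 ∧ U ≤ g2 ∧ U ≤ η ∧ t ≤ U := by
      rcases le_total k2 g2 with hkg | hgk
      · rcases le_total k2 η with hke | hek
        · exact ⟨k2, (Or.inr (Or.inl rfl)), le_refl k2, hkg, hke, htk2⟩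
        · exact ⟨η, hηS, hek, hek.trans hkg, le_refl η, htη⟩
      · rcases le_total g2 η with hge | heg
        · exact ⟨g2, (Or.inr (Or.inr (Or.inr (Or.inl rfl)))), hgk, le_refl g2, hge, htg2⟩
        · exact ⟨η, hηS, heg.trans hgk, heg, le_refl η, htη⟩
    have hLU : L ≤ U := hLt.trans htU
    have e0 : (c0 + τ * (1 - σ) * ((1 - s) * L + s * L) + s * (1 - τ) * ((1 - σ) * L + σ * η)) ≤ C * (L / α00) ^ ly * (L / α01) ^ lk * (L / α01) ^ lg * (η / α11) ^ lh * (((1 - s) * L + s * L) / ((1 - s) * α00 + s * α01)) ^ lX * (((1 - σ) * L + σ * η) / ((1 - σ) * α01 + σ * α11)) ^ lH :=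
      hV L L L η hαL (le_refl L) hk1L (hLU.trans hUk2) hg1L (hLU.trans hUg2) (le_refl L) (hLU.trans hUη) hη1 hη2 (Or.inr rfl) hLS hLS hηS
    have e1 : (c0 + τ * (1 - σ) * ((1 - s) * U + s * U) + s * (1 - τ) * ((1 - σ) * U + σ * η)) ≤ C * (U / α00) ^ ly * (U / α01) ^ lk * (U / α01) ^ lg * (η / α11) ^ lh * (((1 - s) * U + s * U) / ((1 - s) * α00 + s * α01)) ^ lX * (((1 - σ) * U + σ * η) / ((1 - σ) * α01 + σ * α11)) ^ lH :=
      hV U U U η (hαL.trans hLU) (le_refl U) (hk1L.trans hLU) hUk2 (hg1L.trans hLU) hUg2 (le_refl U) hUη hη1 hη2 (Or.inr rfl) hUS hUS hηS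
    exact bfib_ykg hP η L U hηα hη1' hLp e0 e1 t hLt htU
  -- the diagonal points (α00,t,t,t) and (t,t,t,t) when h1 ≤ t (t is then inside [max(L,h1), min(k2,g2,h2)])
  have diagA : h1 ≤ t → (c0 + τ * (1 - σ) * ((1 - s) * α00 + s * t) + s * (1 - τ) * ((1 - σ) * t + σ * t)) ≤ C * (α00 / α00) ^ ly * (t / α01) ^ lk * (t / α01) ^ lg * (t / α11) ^ lh * (((1 - s) * α00 + s * t) / ((1 - s) * α00 + s * α01)) ^ lX * (((1 - σ) * t + σ * t) / ((1 - σ) * α01 + σ * α11)) ^ lH := by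
    intro hh1t
    obtain ⟨L', hL'S, hk1L', hg1L', hh1L', hL't⟩ : ∃ L' : ℝ, (L' = k1 ∨ L' = k2 ∨ L' = g1 ∨ L' = g2 ∨ L' = h1 ∨ L' = h2) ∧ k1 ≤ L' ∧ g1 ≤ L' ∧ h1 ≤ L' ∧ L' ≤ t := by
      rcases le_total h1 L with hhL | hLh
      · exact ⟨L, hLS, hk1L, hg1L, hhL, hLt⟩
      · exact ⟨h1, (Or.inr (Or.inr (Or.inr (Or.inr (Or.inl rfl))))), hk1L.trans hLh, hg1L.trans hLh, le_refl h1, hh1t⟩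
    obtain ⟨U, hUS, hUk2, hUg2, hUh2, htU⟩ : ∃ U : ℝ, (U = k1 ∨ U = k2 ∨ U = g1 ∨ U = g2 ∨ U = h1 ∨ U = h2) ∧ U ≤ k2 ∧ U ≤ g2 ∧ U ≤ h2 ∧ t ≤ U := by
      rcases le_total k2 g2 with hkg | hgk
      · rcases le_total k2 h2 with hke | hek
        · exact ⟨k2, (Or.inr (Or.inl rfl)), le_refl k2, hkg, hke, htk2⟩
        · exact ⟨h2, (Or.inr (Or.inr (Or.inr (Or.inr (Or.inr rfl))))), hek, hek.trans hkg, le_refl h2, hth2⟩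
      · rcases le_total g2 h2 with hge | heg
        · exact ⟨g2, (Or.inr (Or.inr (Or.inr (Or.inl rfl)))), hgk, le_refl g2, hge, htg2⟩
        · exact ⟨h2, (Or.inr (Or.inr (Or.inr (Or.inr (Or.inr rfl))))), heg.trans hgk, heg, le_refl h2, hth2⟩
    have hL'p : 0 < L' := lt_of_lt_of_le hk1p hk1L'
    have hαL' : α00 ≤ L' := h01.trans (hk1.trans hk1L')
    have hLU : L' ≤ U := hL't.trans htU
    have e0 : (c0 + τ * (1 - σ) * ((1 - s) * α00 + s * L') + s * (1 - τ) * ((1 - σ) * L' + σ * L')) ≤ C * (α00 / α00) ^ ly * (L' / α01) ^ lk * (L' / α01) ^ lg * (L' / α11) ^ lh * (((1 - s) * α00 + s * L') / ((1 - s) * α00 + s * α01)) ^ lX * (((1 - σ) * L' + σ * L') / ((1 - σ) * α01 + σ * α11)) ^ lH :=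
      hV α00 L' L' L' (le_refl α00) hαL' hk1L' (hLU.trans hUk2) hg1L' (hLU.trans hUg2) (le_refl L') (le_refl L') hh1L' (hLU.trans hUh2) (Or.inl rfl) hL'S hL'S hL'S
    have e1 : (c0 + τ * (1 - σ) * ((1 - s) * α00 + s * U) + s * (1 - τ) * ((1 - σ) * U + σ * U)) ≤ C * (α00 / α00) ^ ly * (U / α01) ^ lk * (U / α01) ^ lg * (U / α11) ^ lh * (((1 - s) * α00 + s * U) / ((1 - s) * α00 + s * α01)) ^ lX * (((1 - σ) * U + σ * U) / ((1 - σ) * α01 + σ * α11)) ^ lH :=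
      hV α00 U U U (le_refl α00) (hαL'.trans hLU) (hk1L'.trans hLU) hUk2 (hg1L'.trans hLU) hUg2 (le_refl U) (le_refl U) (hh1L'.trans hLU) hUh2 (Or.inl rfl) hUS hUS hUS
    exact bfib_kgh hP L' U hL'p e0 e1 t hL't htU
  have diagB : h1 ≤ t → (c0 + τ * (1 - σ) * ((1 - s) * t + s * t) + s * (1 - τ) * ((1 - σ) * t + σ * t)) ≤ C * (t / α00) ^ ly * (t / α01) ^ lk * (t / α01) ^ lg * (t / α11) ^ lh * (((1 - s) * t + s * t) / ((1 - s) * α00 + s * α01)) ^ lX * (((1 - σ) * t + σ * t) / ((1 - σ) * α01 + σ * α11)) ^ lH := by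
    intro hh1t
    obtain ⟨L', hL'S, hk1L', hg1L', hh1L', hL't⟩ : ∃ L' : ℝ, (L' = k1 ∨ L' = k2 ∨ L' = g1 ∨ L' = g2 ∨ L' = h1 ∨ L' = h2) ∧ k1 ≤ L' ∧ g1 ≤ L' ∧ h1 ≤ L' ∧ L' ≤ t := by
      rcases le_total h1 L with hhL | hLh
      · exact ⟨L, hLS, hk1L, hg1L, hhL, hLt⟩
      · exact ⟨h1, (Or.inr (Or.inr (Or.inr (Or.inr (Or.inl rfl))))), hk1L.trans hLh, hg1L.trans hLh, le_refl h1, hh1t⟩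
    obtain ⟨U, hUS, hUk2, hUg2, hUh2, htU⟩ : ∃ U : ℝ, (U = k1 ∨ U = k2 ∨ U = g1 ∨ U = g2 ∨ U = h1 ∨ U = h2) ∧ U ≤ k2 ∧ U ≤ g2 ∧ U ≤ h2 ∧ t ≤ U := by
      rcases le_total k2 g2 with hkg | hgk
      · rcases le_total k2 h2 with hke | hek
        · exact ⟨k2, (Or.inr (Or.inl rfl)), le_refl k2, hkg, hke, htk2⟩
        · exact ⟨h2, (Or.inr (Or.inr (Or.inr (Or.inr (Or.inr rfl))))), hek, hek.trans hkg, le_refl h2, hth2⟩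
      · rcases le_total g2 h2 with hge | heg
        · exact ⟨g2, (Or.inr (Or.inr (Or.inr (Or.inl rfl)))), hgk, le_refl g2, hge, htg2⟩
        · exact ⟨h2, (Or.inr (Or.inr (Or.inr (Or.inr (Or.inr rfl))))), heg.trans hgk, heg, le_refl h2, hth2⟩
    have hL'p : 0 < L' := lt_of_lt_of_le hk1p hk1L'
    have hαL' : α00 ≤ L' := h01.trans (hk1.trans hk1L')
    have hLU : L' ≤ U := hL't.trans htU
    have e0 : (c0 + τ * (1 - σ) * ((1 - s) * L' + s * L') + s * (1 - τ) * ((1 - σ) * L' + σ * L')) ≤ C * (L' / α00) ^ ly * (L' / α01) ^ lk * (L' / α01) ^ lg * (L' / α11) ^ lh * (((1 - s) * L' + s * L') / ((1 - s) * α00 + s * α01)) ^ lX * (((1 - σ) * L' + σ * L') / ((1 - σ) * α01 + σ * α11)) ^ lH :=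
      hV L' L' L' L' hαL' (le_refl L') hk1L' (hLU.trans hUk2) hg1L' (hLU.trans hUg2) (le_refl L') (le_refl L') hh1L' (hLU.trans hUh2) (Or.inr rfl) hL'S hL'S hL'S
    have e1 : (c0 + τ * (1 - σ) * ((1 - s) * U + s * U) + s * (1 - τ) * ((1 - σ) * U + σ * U)) ≤ C * (U / α00) ^ ly * (U / α01) ^ lk * (U / α01) ^ lg * (U / α11) ^ lh * (((1 - s) * U + s * U) / ((1 - s) * α00 + s * α01)) ^ lX * (((1 - σ) * U + σ * U) / ((1 - σ) * α01 + σ * α11)) ^ lH :=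
      hV U U U U (hαL'.trans hLU) (le_refl U) (hk1L'.trans hLU) hUk2 (hg1L'.trans hLU) hUg2 (le_refl U) (le_refl U) (hh1L'.trans hLU) hUh2 (Or.inr rfl) hUS hUS hUS
    exact bfib_all hP L' U hL'p e0 e1 t hL't htU
  -- endpoint A: (α00,t,t,h) by the h-fibre from η0 = max(h1,t) to h2
  have eA : (c0 + τ * (1 - σ) * ((1 - s) * α00 + s * t) + s * (1 - τ) * ((1 - σ) * t + σ * h)) ≤ C * (α00 / α00) ^ ly * (t / α01) ^ lk * (t / α01) ^ lg * (h / α11) ^ lh * (((1 - s) * α00 + s * t) / ((1 - s) * α00 + s * α01)) ^ lX * (((1 - σ) * t + σ * h) / ((1 - σ) * α01 + σ * α11)) ^ lH := by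
    rcases le_total t h1 with hth1 | hh1t
    · exact bfib_h hP α00 t t h1 h2 (le_refl α00) htα htα hh1p (edgeA h1 (Or.inr (Or.inr (Or.inr (Or.inr (Or.inl rfl))))) (le_refl h1) hh12 hth1) (edgeA h2 (Or.inr (Or.inr (Or.inr (Or.inr (Or.inr rfl))))) hh12 (le_refl h2) hth2) h hh1h hhh2
    · exact bfib_h hP α00 t t t h2 (le_refl α00) htα htα htp (diagA hh1t) (edgeA h2 (Or.inr (Or.inr (Or.inr (Or.inr (Or.inr rfl))))) hh12 (le_refl h2) hth2) h hth hhh2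
  have eB : (c0 + τ * (1 - σ) * ((1 - s) * t + s * t) + s * (1 - τ) * ((1 - σ) * t + σ * h)) ≤ C * (t / α00) ^ ly * (t / α01) ^ lk * (t / α01) ^ lg * (h / α11) ^ lh * (((1 - s) * t + s * t) / ((1 - s) * α00 + s * α01)) ^ lX * (((1 - σ) * t + σ * h) / ((1 - σ) * α01 + σ * α11)) ^ lH := by
    rcases le_total t h1 with hth1 | hh1t
    · exact bfib_h hP t t t h1 h2 (h01.trans htα) htα htα hh1p (edgeB h1 (Or.inr (Or.inr (Or.inr (Or.inr (Or.inl rfl))))) (le_refl h1) hh12 hth1) (edgeB h2 (Or.inr (Or.inr (Or.inr (Or.inr (Or.inr rfl))))) hh12 (le_refl h2) hth2) h hh1h hhh2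
    · exact bfib_h hP t t t t h2 (h01.trans htα) htα htα htp (diagB hh1t) (edgeB h2 (Or.inr (Or.inr (Or.inr (Or.inr (Or.inr rfl))))) hh12 (le_refl h2) hth2) h hth hhh2
  exact bfib_y hP t t h α00 t htα htα (hh1.trans hh1h) hα00 eA eB y hy hyt

/-- Facet `g = h ≤ k` of the box: every petal `(y,k,t,t)` with `t ∈ [g₁,g₂] ∩ [h₁,h₂]`, `t ≤ k` (tied fibre `g = h` between
`t = max(g₁,h₁)` (a `g = c` facet point) and `t = min(g₂,h₂,k)` (a facet point or a `g = k = h` point of `box_faceII`)). [this work] -/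
theorem box_faceIII : ∀ y k t : ℝ, α00 ≤ y → y ≤ k → k1 ≤ k → k ≤ k2 → g1 ≤ t → t ≤ g2 → h1 ≤ t → t ≤ h2 → t ≤ k →
    (c0 + τ * (1 - σ) * ((1 - s) * y + s * k) + s * (1 - τ) * ((1 - σ) * t + σ * t)) ≤ C * (y / α00) ^ ly * (k / α01) ^ lk * (t / α01) ^ lg * (t / α11) ^ lh * (((1 - s) * y + s * k) / ((1 - s) * α00 + s * α01)) ^ lX * (((1 - σ) * t + σ * t) / ((1 - σ) * α01 + σ * α11)) ^ lH := by
  have FC := box_faceC hP hB hV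
  have FII := box_faceII hP hB hV
  obtain ⟨hτ0, hτ1, hσ0, hσ1, hs0, hs1, hα00, h01, h11, hα1, hc0, hly, hlk, hlg, hlh, hlX, hlH, hC0⟩ := id hP
  obtain ⟨hk1, hk12, hk21, hg1, hg12, hh1, hh12, hh21⟩ := id hB
  have hα01 : 0 < α01 := lt_of_lt_of_le hα00 h01
  have hα11 : 0 < α11 := lt_of_lt_of_le hα01 h11
  have hk1p : 0 < k1 := lt_of_lt_of_le hα01 hk1
  have hg1p : 0 < g1 := lt_of_lt_of_le hα01 hg1
  have hh1p : 0 < h1 := lt_of_lt_of_le hα11 hh1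
  intro y k t hy hyk hk1k hkk2 hg1t htg2 hh1t hth2 htk
  -- lower endpoint L = max(g1,h1): a facet point (y,k,L,L)
  obtain ⟨L, hLS, hg1L, hh1L, hLt, hLg2, hLh2⟩ : ∃ L : ℝ, (L = k1 ∨ L = k2 ∨ L = g1 ∨ L = g2 ∨ L = h1 ∨ L = h2) ∧ g1 ≤ L ∧ h1 ≤ L ∧ L ≤ t ∧ L ≤ g2 ∧ L ≤ h2 := by
    rcases le_total h1 g1 with hhg | hgh
    · exact ⟨g1, (Or.inr (Or.inr (Or.inl rfl))), le_refl g1, hhg, hg1t, hg12, hg1t.trans hth2⟩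
    · exact ⟨h1, (Or.inr (Or.inr (Or.inr (Or.inr (Or.inl rfl))))), hgh, le_refl h1, hh1t, hh1t.trans htg2, hh12⟩
  have hLp : 0 < L := lt_of_lt_of_le hg1p hg1L
  have e0 : (c0 + τ * (1 - σ) * ((1 - s) * y + s * k) + s * (1 - τ) * ((1 - σ) * L + σ * L)) ≤ C * (y / α00) ^ ly * (k / α01) ^ lk * (L / α01) ^ lg * (L / α11) ^ lh * (((1 - s) * y + s * k) / ((1 - s) * α00 + s * α01)) ^ lX * (((1 - σ) * L + σ * L) / ((1 - σ) * α01 + σ * α11)) ^ lH := FC L hg1L hLg2 hLS y k L hy hyk hk1k hkk2 (hLt.trans htk) (le_refl L) hh1L hLh2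
  -- upper endpoint U = min(g2,h2,k)
  rcases le_total k g2 with hkg2 | hg2k
  · rcases le_total k h2 with hkh2 | hh2k
    · -- U = k: the point (y,k,k,k) lies on the facet g = k ≤ h
      have e1 : (c0 + τ * (1 - σ) * ((1 - s) * y + s * k) + s * (1 - τ) * ((1 - σ) * k + σ * k)) ≤ C * (y / α00) ^ ly * (k / α01) ^ lk * (k / α01) ^ lg * (k / α11) ^ lh * (((1 - s) * y + s * k) / ((1 - s) * α00 + s * α01)) ^ lX * (((1 - σ) * k + σ * k) / ((1 - σ) * α01 + σ * α11)) ^ lH := FII y k k hy hyk hk1k hkk2 (hg1t.trans htk) hkg2 (le_refl k) (hh1t.trans htk) hkh2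
      exact bfib_gh hP y k L k hy (hk1.trans hk1k) hLp e0 e1 t hLt htk
    · -- U = h2
      have e1 : (c0 + τ * (1 - σ) * ((1 - s) * y + s * k) + s * (1 - τ) * ((1 - σ) * h2 + σ * h2)) ≤ C * (y / α00) ^ ly * (k / α01) ^ lk * (h2 / α01) ^ lg * (h2 / α11) ^ lh * (((1 - s) * y + s * k) / ((1 - s) * α00 + s * α01)) ^ lX * (((1 - σ) * h2 + σ * h2) / ((1 - σ) * α01 + σ * α11)) ^ lH := FC h2 (hg1t.trans hth2) (hh2k.trans hkg2) (Or.inr (Or.inr (Or.inr (Or.inr (Or.inr rfl))))) y k h2 hy hyk hk1k hkk2 hh2k (le_refl h2) hh12 (le_refl h2)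
      exact bfib_gh hP y k L h2 hy (hk1.trans hk1k) hLp e0 e1 t hLt hth2
  · rcases le_total g2 h2 with hgh | hhg
    · -- U = g2
      have e1 : (c0 + τ * (1 - σ) * ((1 - s) * y + s * k) + s * (1 - τ) * ((1 - σ) * g2 + σ * g2)) ≤ C * (y / α00) ^ ly * (k / α01) ^ lk * (g2 / α01) ^ lg * (g2 / α11) ^ lh * (((1 - s) * y + s * k) / ((1 - s) * α00 + s * α01)) ^ lX * (((1 - σ) * g2 + σ * g2) / ((1 - σ) * α01 + σ * α11)) ^ lH := FC g2 hg12 (le_refl g2) (Or.inr (Or.inr (Or.inr (Or.inl rfl)))) y k g2 hy hyk hk1k hkk2 hg2k (le_refl g2) (hh1t.trans htg2) hgh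
      exact bfib_gh hP y k L g2 hy (hk1.trans hk1k) hLp e0 e1 t hLt htg2
    · -- U = h2 (h2 ≤ g2 ≤ k)
      have e1 : (c0 + τ * (1 - σ) * ((1 - s) * y + s * k) + s * (1 - τ) * ((1 - σ) * h2 + σ * h2)) ≤ C * (y / α00) ^ ly * (k / α01) ^ lk * (h2 / α01) ^ lg * (h2 / α11) ^ lh * (((1 - s) * y + s * k) / ((1 - s) * α00 + s * α01)) ^ lX * (((1 - σ) * h2 + σ * h2) / ((1 - σ) * α01 + σ * α11)) ^ lH := FC h2 (hg1t.trans hth2) hhg (Or.inr (Or.inr (Or.inr (Or.inr (Or.inr rfl))))) y k h2 hy hyk hk1k hkk2 (hhg.trans hg2k) (le_refl h2) hh12 (le_refl h2)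
      exact bfib_gh hP y k L h2 hy (hk1.trans hk1k) hLp e0 e1 t hLt hth2

/-- **Exact vertex reduction on a box.**  Under the grid hypothesis, the six-budget power inequality with constant `C` holds at
EVERY petal of the box `{k ∈ [k₁,k₂], g ∈ [g₁,g₂], h ∈ [h₁,h₂]}` (fibre `g` from the facet `g = g₁` to `g = min(g₂,k,h)`). [this work] -/
theorem box_one_petal : ∀ y k gc h : ℝ, α00 ≤ y → y ≤ k → k1 ≤ k → k ≤ k2 → g1 ≤ gc → gc ≤ g2 → gc ≤ k → gc ≤ h → h1 ≤ h → h ≤ h2 →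
    (c0 + τ * (1 - σ) * ((1 - s) * y + s * k) + s * (1 - τ) * ((1 - σ) * gc + σ * h)) ≤ C * (y / α00) ^ ly * (k / α01) ^ lk * (gc / α01) ^ lg * (h / α11) ^ lh * (((1 - s) * y + s * k) / ((1 - s) * α00 + s * α01)) ^ lX * (((1 - σ) * gc + σ * h) / ((1 - σ) * α01 + σ * α11)) ^ lH := by
  have FC := box_faceC hP hB hV
  have FII := box_faceII hP hB hV
  have FIII := box_faceIII hP hB hV
  obtain ⟨hτ0, hτ1, hσ0, hσ1, hs0, hs1, hα00, h01, h11, hα1, hc0, hly, hlk, hlg, hlh, hlX, hlH, hC0⟩ := id hP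
  obtain ⟨hk1, hk12, hk21, hg1, hg12, hh1, hh12, hh21⟩ := id hB
  have hα01 : 0 < α01 := lt_of_lt_of_le hα00 h01
  have hα11 : 0 < α11 := lt_of_lt_of_le hα01 h11
  have hk1p : 0 < k1 := lt_of_lt_of_le hα01 hk1
  have hg1p : 0 < g1 := lt_of_lt_of_le hα01 hg1
  have hh1p : 0 < h1 := lt_of_lt_of_le hα11 hh1
  intro y k gc h hy hyk hk1k hkk2 hg1g hgg2 hgk hgh hh1h hhh2
  have hkα : α01 ≤ k := hk1.trans hk1k
  have hhα : α11 ≤ h := hh1.trans hh1h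
  have e0 : (c0 + τ * (1 - σ) * ((1 - s) * y + s * k) + s * (1 - τ) * ((1 - σ) * g1 + σ * h)) ≤ C * (y / α00) ^ ly * (k / α01) ^ lk * (g1 / α01) ^ lg * (h / α11) ^ lh * (((1 - s) * y + s * k) / ((1 - s) * α00 + s * α01)) ^ lX * (((1 - σ) * g1 + σ * h) / ((1 - σ) * α01 + σ * α11)) ^ lH := FC g1 (le_refl g1) hg12 (Or.inr (Or.inr (Or.inl rfl))) y k h hy hyk hk1k hkk2 (hg1g.trans hgk) (hg1g.trans hgh) hh1h hhh2
  rcases le_total k h with hkh | hhk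
  · rcases le_total k g2 with hkg2 | hg2k
    · -- upper endpoint g = k (≤ h, ≤ g2)
      have e1 : (c0 + τ * (1 - σ) * ((1 - s) * y + s * k) + s * (1 - τ) * ((1 - σ) * k + σ * h)) ≤ C * (y / α00) ^ ly * (k / α01) ^ lk * (k / α01) ^ lg * (h / α11) ^ lh * (((1 - s) * y + s * k) / ((1 - s) * α00 + s * α01)) ^ lX * (((1 - σ) * k + σ * h) / ((1 - σ) * α01 + σ * α11)) ^ lH := FII y k h hy hyk hk1k hkk2 (hg1g.trans hgk) hkg2 hkh hh1h hhh2
      exact bfib_g hP y k h g1 k hy hkα hhα hg1p e0 e1 gc hg1g hgk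
    · -- upper endpoint g = g2
      have e1 : (c0 + τ * (1 - σ) * ((1 - s) * y + s * k) + s * (1 - τ) * ((1 - σ) * g2 + σ * h)) ≤ C * (y / α00) ^ ly * (k / α01) ^ lk * (g2 / α01) ^ lg * (h / α11) ^ lh * (((1 - s) * y + s * k) / ((1 - s) * α00 + s * α01)) ^ lX * (((1 - σ) * g2 + σ * h) / ((1 - σ) * α01 + σ * α11)) ^ lH := FC g2 hg12 (le_refl g2) (Or.inr (Or.inr (Or.inr (Or.inl rfl)))) y k h hy hyk hk1k hkk2 hg2k (hg2k.trans hkh) hh1h hhh2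
      exact bfib_g hP y k h g1 g2 hy hkα hhα hg1p e0 e1 gc hg1g hgg2
  · rcases le_total h g2 with hhg2 | hg2h
    · -- upper endpoint g = h (≤ k, ≤ g2)
      have e1 : (c0 + τ * (1 - σ) * ((1 - s) * y + s * k) + s * (1 - τ) * ((1 - σ) * h + σ * h)) ≤ C * (y / α00) ^ ly * (k / α01) ^ lk * (h / α01) ^ lg * (h / α11) ^ lh * (((1 - s) * y + s * k) / ((1 - s) * α00 + s * α01)) ^ lX * (((1 - σ) * h + σ * h) / ((1 - σ) * α01 + σ * α11)) ^ lH := FIII y k h hy hyk hk1k hkk2 (hg1g.trans hgh) hhg2 hh1h hhh2 hhk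
      exact bfib_g hP y k h g1 h hy hkα hhα hg1p e0 e1 gc hg1g hgh
    · have e1 : (c0 + τ * (1 - σ) * ((1 - s) * y + s * k) + s * (1 - τ) * ((1 - σ) * g2 + σ * h)) ≤ C * (y / α00) ^ ly * (k / α01) ^ lk * (g2 / α01) ^ lg * (h / α11) ^ lh * (((1 - s) * y + s * k) / ((1 - s) * α00 + s * α01)) ^ lX * (((1 - σ) * g2 + σ * h) / ((1 - σ) * α01 + σ * α11)) ^ lH := FC g2 hg12 (le_refl g2) (Or.inr (Or.inr (Or.inr (Or.inl rfl)))) y k h hy hyk hk1k hkk2 (hg2h.trans hhk) hg2h hh1h hhh2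
      exact bfib_g hP y k h g1 g2 hy hkα hhα hg1p e0 e1 gc hg1g hgg2

end BoxReduction

end Summit.CriticalPhenomena.PercolationContinuityZ3.Theorems.SunflowerPartition.SafeCalc.LinkedCurrency
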